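import Summits.FinalStateConjecture.FinalStateConjecture.Theses.KerrnessPropagates
import Literature.Geometry.Lorentzian.KerrSchildCoord
import Literature.Geometry.Lorentzian.ChartCalculus
import Literature.Geometry.Lorentzian.KerrConvergenceProofs

/-!
# `KillingSpinorEndgame` (crux `stmt-FinalStateConjecture-17645`, route KerrnessPropagates, rank 2) —
# negative-side lemma I (transport): the lab time of the recurrence slab is a chart label — an
# `ε`-good slab translates along any common Killing translation of the configuration

Refuter seat `refuter-rattack-stmt-FinalStateConjecture-17645-0` (crux attack / vetting, 2026-08-17).
Kernel-checked, `sorry`-free, no definitions, no named facts; nothing here closes the item.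

Clause (i) of the crux (and of `KerrBasinCapture`, `SingleKerrEndgame`) says: for every `ε > 0` and
every `τ₁` there is a lab time `τ ≥ τ₁` and ONE chart `Φ : U → M` about the punctured hyperplane
`{x⁰ = τ, rⱼ > r₀ⱼ}` which is `ε`-close to boosted Kerr–Schild Kerrᵢ on the near discs and `ε`-flat on
the far zone, with achronal slab image in `J⁺(ιX)` and `Φ_*∂₀` future-directed on the far zone. But `τ`
is a coordinate of the chart, and the chart is chosen AFTER `τ`. If `w ∈ E4` is a common Killing
translation of the configuration — `Λⱼ⁻¹ w ∈ ℝ ∂₀` for every hole `j` (always for `N = 0`; `w = Λe₀`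
for `N = 1`; comoving holes in general) — then precomposing `Φ` with `y ↦ y + w` carries every clause at
lab time `τ` to the same clauses at lab time `τ − w⁰` (`slab_translate`): the Poincaré maps are affine,
the rest-frame Kerr–Schild radius and form are stationary (`Kerr.radius_add_time_smul_basisVector`,
`Kerr.bilin_add_smul_basisVector_zero`), `η` is constant, `Cᵏ` sup norms commute with translations
(`iteratedFDeriv_comp_add_right`), and `d(Φ ∘ (· + w)) = dΦ`. The consequences — one `ε`-good slab
gives an `ε`-good slab at EVERY lab time, so for comoving configurations (`N = 0`, `N = 1`, equal
Lorentz parts) the lateness quantifier `∀ τ₁, ∃ τ ≥ τ₁` of clause (i) is equivalent to a bare `∃ τ`,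
and by name the crux already decides comoving-recurrent developments with no lateness — are drawn in
`Negative/LatenessDecoration.lean`. For `N ≥ 2` holes with pairwise distinct 4-velocities no common `w`
exists (separations `∝ τ`) and nothing is claimed there. On the way: `Cᵏ` sup norms of translates
(`supCkENorm_comp_add_le`) and the transport of the zero-extended deviation along a translation of
the chart domain (`deviationExtend_comp_translate`).

## References

* R. P. Kerr, A. Schild (1965), §2 (stationarity and Lorentz covariance of the Kerr–Schild form).
* B. O'Neill, *Semi-Riemannian Geometry* (1983), Ch. 9, pp. 233–236 (Lorentz and Poincaré maps).
* M. Dafermos, G. Holzegel, I. Rodnianski, M. Taylor, arXiv:2104.08222, §1 (charts, `Cᵏ` deviations).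
-/

noncomputable section

-- the doubled `FinalStateConjecture.FinalStateConjecture` path component trips dupNamespace
set_option linter.dupNamespace false

open Bundle TopologicalSpace Set Function Filter
open scoped Manifold ContDiff Topology ENNReal

namespace Summit.FinalStateConjecture.FinalStateConjecture.Theorems.KillingSpinorEndgame.Negative

open Literature.Geometry.Lorentzian

/-! ### A piece of calculus -/

section Calculus

variable {F G : Type*} [NormedAddCommGroup F] [NormedSpace ℝ F] [NormedAddCommGroup G]
  [NormedSpace ℝ G]

/-- **`Cᵏ` sup norms of a translate**: if `S + w ⊆ T` then `‖f (· + w)‖_{Cᵏ(S)} ≤ ‖f‖_{Cᵏ(T)}`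
(translation commutes with `iteratedFDeriv`; Bartnik 1986, (1.3) for the norm). [folklore] -/
theorem supCkENorm_comp_add_le {S T : Set F} (w : F) (hST : ∀ y ∈ S, y + w ∈ T) (k : ℕ)
    (f : F → G) : supCkENorm S k (fun y ↦ f (y + w)) ≤ supCkENorm T k f := by
  unfold supCkENorm
  refine iSup₂_le fun m hm ↦ iSup₂_le fun y hy ↦ ?_
  rw [iteratedFDeriv_comp_add_right]
  exact le_iSup₂_of_le m hm (le_iSup₂_of_le (y + w) (hST y hy) le_rfl)

end Calculus

/-! ### Transport of the deviation along a translation of the chart domain -/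

section Deviation

universe u

variable (𝓢 : Spacetime.{u} 4)

/-- **The deviation of a translated chart is the translate of the deviation**, for a reference form
invariant under the translation: if `σ : U' → U` is `y ↦ y + w` between open subsets of `E4`
(`U' = U − w`), smooth with `dσ = id`, and `G (z + w) = G z`, then the zero-extended deviation of
`Φ ∘ σ` from `⟨U', G, t', r'⟩` is `z ↦ (deviation of Φ from ⟨U, G, t, r⟩)(z + w)` (chain rule; off the
domains both sides are the junk value `0`). DHRT arXiv:2104.08222, §1 for the deviation. [folklore] -/
theorem deviationExtend_comp_translate {U U' : Opens E4} (w : E4)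
    (hUU' : ∀ z : E4, z ∈ (U' : Set E4) ↔ z + w ∈ (U : Set E4)) (σ : U' → U)
    (hσ : ∀ y, ((σ y : U) : E4) = (y : E4) + w) (hσs : ContMDiff 𝓘(ℝ, E4) 𝓘(ℝ, E4) ∞ σ)
    (hσd : ∀ (y : U') (v : E4), mfderiv 𝓘(ℝ, E4) 𝓘(ℝ, E4) σ y v = v)
    {Φ : U → 𝓢.carrier} (hΦ : ContMDiff 𝓘(ℝ, E4) (𝓡 4) ∞ Φ)
    (G : E4 → E4 →L[ℝ] E4 →L[ℝ] ℝ) (hG : ∀ z, G (z + w) = G z) (t r t' r' : E4 → ℝ) :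
    𝓢.deviationExtend ⟨U', G, t', r'⟩ (Φ ∘ σ) = fun z ↦ 𝓢.deviationExtend ⟨U, G, t, r⟩ Φ (z + w) := by
  -- chain rule: `d(Φ ∘ σ)_y v = dΦ_{σ y} v`
  have hchain : ∀ (y : U') (v : E4),
      mfderiv 𝓘(ℝ, E4) (𝓡 4) (Φ ∘ σ) y v = mfderiv 𝓘(ℝ, E4) (𝓡 4) Φ (σ y) v := by
    intro y v
    have h := DFunLike.congr_fun (mfderiv_comp y ((hΦ (σ y)).mdifferentiableAt (by simp))
      ((hσs y).mdifferentiableAt (by simp))) v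
    exact h.trans (congrArg (mfderiv 𝓘(ℝ, E4) (𝓡 4) Φ (σ y)) (hσd y v))
  funext z
  by_cases hz : z ∈ (U' : Set E4)
  · have hzw : z + w ∈ (U : Set E4) := (hUU' z).1 hz
    have hσz : σ ⟨z, hz⟩ = ⟨z + w, hzw⟩ := Subtype.ext (hσ ⟨z, hz⟩)
    have h1 := 𝓢.deviationExtend_coe ⟨U', G, t', r'⟩ (Φ ∘ σ) ⟨z, hz⟩
    have h2 := 𝓢.deviationExtend_coe ⟨U, G, t, r⟩ Φ ⟨z + w, hzw⟩
    simp only at h1 h2 ⊢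
    rw [h1, h2]
    ext v v'
    rw [Spacetime.deviation_apply, Spacetime.deviation_apply, hchain, hchain, Function.comp_apply,
      hσz]
    show _ - G z v v' = _ - G (z + w) v v'
    rw [hG]
  · have hzw : z + w ∉ (U : Set E4) := fun h ↦ hz ((hUU' z).2 h)
    rw [𝓢.deviationExtend_of_not_mem ⟨U', G, t', r'⟩ _ hz,
      𝓢.deviationExtend_of_not_mem ⟨U, G, t, r⟩ _ hzw]

end Deviation

/-! ### The slab clause of the crux is invariant under common Killing translations -/

section Transport

variable {X : Type} [TopologicalSpace X] [ChartedSpace E3 X] [IsManifold (𝓡 3) ∞ X]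
  [ConnectedSpace X] {D : InitialDataSet (𝓡 3) X}

/-- **Transport of an `ε`-good slab along a common Killing translation.** Let `w ∈ E4` satisfy
`Λⱼ⁻¹ w = sⱼ ∂₀` for every hole `j` of the configuration `(N; M, a, r₀; mo)`. If `(R, U, Φ)` witnesses
the slab clause of `KillingSpinorEndgame` (i) at lab time `τ` — VERBATIM the body of the crux after
`∃ τ, τ₁ ≤ τ ∧` — then `(R, U − w, Φ ∘ (· + w))` witnesses it at lab time `τ − w⁰`: rest-frame radii
and the boosted Kerr–Schild forms are invariant under `x ↦ x + w` (Kerr–Schild 1965, §2: stationarity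
and Lorentz covariance), `η` is constant, `Cᵏ` sup norms commute with translations, the slab image,
the chart range and the push-forward of `∂₀` are unchanged. [cite: KerrSchild1965, §2] -/
theorem slab_translate (𝒟 : VacuumCauchyDevelopment D) (k N : ℕ) (M a r₀ : Fin N → ℝ)
    (mo : Fin N → ↥lorentzGroup × E4) (w : E4) (s : Fin N → ℝ)
    (hw : ∀ j, ((mo j).1 : E4 ≃L[ℝ] E4).symm w = s j • E4.basisVector 0) (ε τ : ℝ)
    (h : ∃ (R : Fin N → ℝ) (U : Opens E4) (Φ : U → 𝒟.carrier), (∀ i, r₀ i + 1 ≤ R i) ∧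
      ContMDiff 𝓘(ℝ, E4) (𝓡 4) ∞ Φ ∧ Topology.IsOpenEmbedding Φ ∧
      {x : E4 | x 0 = τ ∧ ∀ j, r₀ j < Kerr.radius (a j) (poincareInv (mo j).1 (mo j).2 x)} ⊆
        (U : Set E4) ∧
      range Φ ⊆ 𝒟.metric.causalFuture 𝒟.timeOrientation (range 𝒟.embed) ∧
      𝒟.metric.IsAchronal 𝒟.timeOrientation (Φ '' {x : ↥U | (x : E4) 0 = τ}) ∧
      (∀ i, supCkENorm {x : E4 | x 0 = τ ∧
          (∀ j, r₀ j < Kerr.radius (a j) (poincareInv (mo j).1 (mo j).2 x)) ∧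
          Kerr.radius (a i) (poincareInv (mo i).1 (mo i).2 x) ≤ R i} k
        (𝒟.toSpacetime.deviationExtend ⟨U, boostedKerrBilin (mo i).1 (mo i).2 (M i) (a i),
          fun x ↦ x 0, fun x ↦ Kerr.radius (a i) (poincareInv (mo i).1 (mo i).2 x)⟩ Φ) ≤
        ENNReal.ofReal ε) ∧
      supCkENorm {x : E4 | x 0 = τ ∧
          (∀ j, r₀ j < Kerr.radius (a j) (poincareInv (mo j).1 (mo j).2 x)) ∧
          ∀ j, R j - 1 ≤ Kerr.radius (a j) (poincareInv (mo j).1 (mo j).2 x)} k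
        (𝒟.toSpacetime.deviationExtend (Minkowski.backgroundOn U) Φ) ≤ ENNReal.ofReal ε ∧
      (∀ x : ↥U, x.1 0 = τ →
        (∀ j, R j - 1 ≤ Kerr.radius (a j) (poincareInv (mo j).1 (mo j).2 x.1)) →
        𝒟.timeOrientation.IsFutureDirected (mfderiv 𝓘(ℝ, E4) (𝓡 4) Φ x (E4.basisVector 0)))) :
    ∃ (R : Fin N → ℝ) (U : Opens E4) (Φ : U → 𝒟.carrier), (∀ i, r₀ i + 1 ≤ R i) ∧
      ContMDiff 𝓘(ℝ, E4) (𝓡 4) ∞ Φ ∧ Topology.IsOpenEmbedding Φ ∧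
      {x : E4 | x 0 = τ - w 0 ∧ ∀ j, r₀ j < Kerr.radius (a j) (poincareInv (mo j).1 (mo j).2 x)} ⊆
        (U : Set E4) ∧
      range Φ ⊆ 𝒟.metric.causalFuture 𝒟.timeOrientation (range 𝒟.embed) ∧
      𝒟.metric.IsAchronal 𝒟.timeOrientation (Φ '' {x : ↥U | (x : E4) 0 = τ - w 0}) ∧
      (∀ i, supCkENorm {x : E4 | x 0 = τ - w 0 ∧
          (∀ j, r₀ j < Kerr.radius (a j) (poincareInv (mo j).1 (mo j).2 x)) ∧
          Kerr.radius (a i) (poincareInv (mo i).1 (mo i).2 x) ≤ R i} k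
        (𝒟.toSpacetime.deviationExtend ⟨U, boostedKerrBilin (mo i).1 (mo i).2 (M i) (a i),
          fun x ↦ x 0, fun x ↦ Kerr.radius (a i) (poincareInv (mo i).1 (mo i).2 x)⟩ Φ) ≤
        ENNReal.ofReal ε) ∧
      supCkENorm {x : E4 | x 0 = τ - w 0 ∧
          (∀ j, r₀ j < Kerr.radius (a j) (poincareInv (mo j).1 (mo j).2 x)) ∧
          ∀ j, R j - 1 ≤ Kerr.radius (a j) (poincareInv (mo j).1 (mo j).2 x)} k
        (𝒟.toSpacetime.deviationExtend (Minkowski.backgroundOn U) Φ) ≤ ENNReal.ofReal ε ∧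
      (∀ x : ↥U, x.1 0 = τ - w 0 →
        (∀ j, R j - 1 ≤ Kerr.radius (a j) (poincareInv (mo j).1 (mo j).2 x.1)) →
        𝒟.timeOrientation.IsFutureDirected (mfderiv 𝓘(ℝ, E4) (𝓡 4) Φ x (E4.basisVector 0))) := by
  obtain ⟨R, U, Φ, h1, h2, h3, h4, h5, h6, h7, h8, h9⟩ := h
  -- affine algebra of the configuration along `w`
  have hp : ∀ (j : Fin N) (y : E4), poincareInv (mo j).1 (mo j).2 (y + w) =
      poincareInv (mo j).1 (mo j).2 y + s j • E4.basisVector 0 := by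
    intro j y
    simp only [poincareInv]
    rw [show y + w - (mo j).2 = (y - (mo j).2) + w by abel, map_add, hw j]
  have hrad : ∀ (j : Fin N) (y : E4), Kerr.radius (a j) (poincareInv (mo j).1 (mo j).2 (y + w)) =
      Kerr.radius (a j) (poincareInv (mo j).1 (mo j).2 y) := by
    intro j y
    rw [hp, Kerr.radius_add_time_smul_basisVector]
  have hbil : ∀ (j : Fin N) (y : E4), boostedKerrBilin (mo j).1 (mo j).2 (M j) (a j) (y + w) =
      boostedKerrBilin (mo j).1 (mo j).2 (M j) (a j) y := by
    intro j y
    ext v v'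
    rw [boostedKerrBilin_apply, boostedKerrBilin_apply, hp, Kerr.bilin_add_smul_basisVector_zero]
  have h0 : ∀ y : E4, (y + w) 0 = y 0 + w 0 := fun y ↦ rfl
  have hτ : ∀ y : E4, y 0 = τ - w 0 → (y + w) 0 = τ := fun y hy ↦ by
    rw [h0, hy, sub_add_cancel]
  -- the translated domain and the translation `σ : U' ≃ₜ U`
  let U' : Opens E4 := ⟨(fun y : E4 ↦ y + w) ⁻¹' (U : Set E4),
    U.isOpen.preimage (continuous_id.add continuous_const)⟩
  have hUU' : ∀ z : E4, z ∈ (U' : Set E4) ↔ z + w ∈ (U : Set E4) := fun z ↦ Iff.rfl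
  let σ : U' ≃ₜ U :=
    { toFun := fun y ↦ ⟨(y : E4) + w, y.2⟩
      invFun := fun x ↦ ⟨(x : E4) - w, show (x : E4) - w + w ∈ (U : Set E4) by
        rw [sub_add_cancel]; exact x.2⟩
      left_inv := fun y ↦ Subtype.ext (add_sub_cancel_right (y : E4) w)
      right_inv := fun x ↦ Subtype.ext (sub_add_cancel (x : E4) w)
      continuous_toFun := (continuous_subtype_val.add continuous_const).subtype_mk _
      continuous_invFun := (continuous_subtype_val.sub continuous_const).subtype_mk _ }
  have hσ : ∀ y : U', ((σ y : U) : E4) = (y : E4) + w := fun _ ↦ rfl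
  have hσs : ContMDiff 𝓘(ℝ, E4) 𝓘(ℝ, E4) ∞ (σ : U' → U) := by
    rw [← ContMDiff.subtypeVal_comp_iff]
    exact contMDiff_subtype_val.add contMDiff_const
  have hσd : ∀ (y : U') (v : E4), mfderiv 𝓘(ℝ, E4) 𝓘(ℝ, E4) (σ : U' → U) y v = v := by
    intro y v
    have hd : MDifferentiableAt 𝓘(ℝ, E4) 𝓘(ℝ, E4) (σ : U' → U) y :=
      (hσs y).mdifferentiableAt (by simp)
    have hval : MDifferentiableAt 𝓘(ℝ, E4) 𝓘(ℝ, E4) (Subtype.val : U → E4) (σ y) :=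
      (contMDiff_subtype_val (I := 𝓘(ℝ, E4)) (n := ∞) (U := U) (σ y)).mdifferentiableAt
        (by simp)
    have hc := mfderiv_comp y hval hd
    have h3' : mfderiv 𝓘(ℝ, E4) 𝓘(ℝ, E4) (Subtype.val ∘ (σ : U' → U)) y v = v := by
      rw [OpensChart.mfderiv_eq y (Subtype.val ∘ (σ : U' → U)) (fun z : E4 ↦ z + w)
        (fun _ ↦ rfl) (differentiableAt_id.add (differentiableAt_const _)), fderiv_add_const,
        fderiv_fun_id]
      rfl
    have e1 : mfderiv 𝓘(ℝ, E4) 𝓘(ℝ, E4) (σ : U' → U) y v =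
        mfderiv 𝓘(ℝ, E4) 𝓘(ℝ, E4) (Subtype.val : U → E4) (σ y)
          (mfderiv 𝓘(ℝ, E4) 𝓘(ℝ, E4) (σ : U' → U) y v) :=
      (OpensChart.mfderiv_subtypeVal_apply _ _).symm
    have e2 : mfderiv 𝓘(ℝ, E4) 𝓘(ℝ, E4) (Subtype.val : U → E4) (σ y)
          (mfderiv 𝓘(ℝ, E4) 𝓘(ℝ, E4) (σ : U' → U) y v) =
        mfderiv 𝓘(ℝ, E4) 𝓘(ℝ, E4) (Subtype.val ∘ (σ : U' → U)) y v :=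
      (DFunLike.congr_fun hc v).symm
    exact e1.trans (e2.trans h3')
  have hchain : ∀ (y : U') (v : E4), mfderiv 𝓘(ℝ, E4) (𝓡 4) (Φ ∘ (σ : U' → U)) y v =
      mfderiv 𝓘(ℝ, E4) (𝓡 4) Φ (σ y) v := by
    intro y v
    have h := DFunLike.congr_fun (mfderiv_comp y ((h2 (σ y)).mdifferentiableAt (by simp))
      ((hσs y).mdifferentiableAt (by simp))) v
    exact h.trans (congrArg (mfderiv 𝓘(ℝ, E4) (𝓡 4) Φ (σ y)) (hσd y v))
  -- the translated witness
  refine ⟨R, U', Φ ∘ (σ : U' → U), h1, h2.comp hσs, h3.comp σ.isOpenEmbedding, ?_, ?_, ?_, ?_,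
    ?_, ?_⟩
  · -- the punctured hyperplane at `τ - w 0` lies in `U'`
    intro y hy
    show y + w ∈ (U : Set E4)
    exact h4 ⟨hτ y hy.1, fun j ↦ by rw [hrad]; exact hy.2 j⟩
  · exact (range_comp_subset_range (σ : U' → U) Φ).trans h5
  · -- the slab image is contained in the old one
    have hsub : (Φ ∘ (σ : U' → U)) '' {y : ↥U' | (y : E4) 0 = τ - w 0} ⊆
        Φ '' {x : ↥U | (x : E4) 0 = τ} := by
      rintro _ ⟨y, hy, rfl⟩
      exact ⟨σ y, hτ y hy, rfl⟩
    exact fun p hp q hq ↦ h6 p (hsub hp) q (hsub hq)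
  · -- near zones
    intro i
    rw [deviationExtend_comp_translate 𝒟.toSpacetime w hUU' (σ : U' → U) hσ hσs hσd h2
      (boostedKerrBilin (mo i).1 (mo i).2 (M i) (a i)) (hbil i) (fun x ↦ x 0)
      (fun x ↦ Kerr.radius (a i) (poincareInv (mo i).1 (mo i).2 x)) (fun x ↦ x 0)
      (fun x ↦ Kerr.radius (a i) (poincareInv (mo i).1 (mo i).2 x))]
    refine (supCkENorm_comp_add_le w ?_ k _).trans (h7 i)
    intro y hy
    exact ⟨hτ y hy.1, fun j ↦ by rw [hrad]; exact hy.2.1 j, by rw [hrad]; exact hy.2.2⟩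
  · -- far zone
    have h8' : supCkENorm {x : E4 | x 0 = τ ∧
        (∀ j, r₀ j < Kerr.radius (a j) (poincareInv (mo j).1 (mo j).2 x)) ∧
        ∀ j, R j - 1 ≤ Kerr.radius (a j) (poincareInv (mo j).1 (mo j).2 x)} k
        (𝒟.toSpacetime.deviationExtend ⟨U, fun _ ↦ Minkowski.bilin, fun x ↦ x 0, E4.spatialNorm⟩
          Φ) ≤ ENNReal.ofReal ε := h8
    show supCkENorm _ k (𝒟.toSpacetime.deviationExtend
      ⟨U', fun _ ↦ Minkowski.bilin, fun x ↦ x 0, E4.spatialNorm⟩ (Φ ∘ (σ : U' → U))) ≤ _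
    rw [deviationExtend_comp_translate 𝒟.toSpacetime w hUU' (σ : U' → U) hσ hσs hσd h2
        (fun _ ↦ Minkowski.bilin) (fun _ ↦ rfl) (fun x ↦ x 0) E4.spatialNorm (fun x ↦ x 0)
        E4.spatialNorm]
    refine (supCkENorm_comp_add_le w ?_ k _).trans h8'
    intro y hy
    exact ⟨hτ y hy.1, fun j ↦ by rw [hrad]; exact hy.2.1 j, fun j ↦ by rw [hrad]; exact hy.2.2 j⟩
  · -- orientation of `∂₀` on the far zone
    intro y hy hfar
    rw [hchain]
    exact h9 (σ y) (hτ y hy) fun j ↦ by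
      show R j - 1 ≤ Kerr.radius (a j) (poincareInv (mo j).1 (mo j).2 ((y : E4) + w))
      rw [hrad]
      exact hfar j

end Transport

end Summit.FinalStateConjecture.FinalStateConjecture.Theorems.KillingSpinorEndgame.Negative
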